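import Summits.CriticalPhenomena.PercolationContinuityZ3.Theorems.PercNearOneGluingNoHeavyLowerTailHubPairApexGlue
import Summits.CriticalPhenomena.PercolationContinuityZ3.Theorems.PercNearOneGluingNoHeavyLowerTailApexTwoSumSums
import HarnessLib

/-!
# `NoHeavyLowerTail` (stmt-CriticalPhenomena-4575) — HUB PAIRS WITH THE APEX ALONE ON ITS SIDE, part 2 (measure level, every `q > 0`):
# the Θ-IDENTITY with an arbitrary far side — the R1 slack of the glued graph is a quadratic form in the wired apex-arm masses

Support file (prover prim-gen-kcluster gen 72; `--supports stmt-CriticalPhenomena-4575`).  No definitions, no named facts, no sorries.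

{η : BondConfig V | h₁ ∉ cl η.toFinset a ∧ h₂ ∉ cl η.toFinset a ∧ h₂ ∉ cl η.toFinset h₁}({h₁, h₂} : Set V)ING (part 1 `…HubPairApexGlue`; KCLUSTER-gen65 §0.1 had the far side a parallel pair of terminal arms).  Supports `DA` (APEX ARM: contains `a`,
meets the rest only in the hubs `h₁ ≠ h₂`) and `DY` (the REST, containing `b, c`; `a` on no pair of `DY`; `b, c` on pairs of `DA` only as hubs;
`c ∈ cl DY b`); `w` vanishing off `DA ∪ DY`, `wA = w·1_{DA}`, `wY = w·1_{DAᶜ}`; `T = {h₁, h₂}`, `K = q^{k^T(∅)}`.  APEX-ARM STATES (partition of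
`{a, h₁, h₂}` in `ω ∩ DA`): `A = {a h₁ h₂}`, `C = {a h₁ | h₂}`, `D = {a h₂ | h₁}`, `B = {a | h₁ h₂}`, `E = {a | h₁ | h₂}`, with `T`-wired masses
`(∑ η : BondConfig V, rcWeightW wA q ({h₁, h₂} : Set V) η * ind {η : BondConfig V | h₁ ∈ cl η.toFinset a ∧ h₂ ∈ cl η.toFinset a} η), …, (∑ η : BondConfig V, rcWeightW wA q ({h₁, h₂} : Set V) η * ind {η : BondConfig V | h₁ ∉ cl η.toFinset a ∧ h₂ ∉ cl η.toFinset a ∧ h₂ ∉ cl η.toFinset h₁} η)`; REFERENCE BLOCKS `g_A = {ah₁, ah₂}`, `g_C = {ah₁}`, `g_D = {ah₂}`, `g_B = {h₁h₂}`, `g_E = ∅` (same partitions).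
* `HubPairApex.pt`, `sum_eq` (DICTIONARY): for events `E_G`, `E` with the replacement property of part 1 (`ω ∈ E_G ↔ g_s ∪ (ω ∖ DA) ∈ E` in state `s`),
  `K · Zφ(E_G) = Σ_s X_s · R_s(E)`, `R_s(E) = Σ_η rcW^T_{wY}(η) 1_E(g_s ∪ η) · q^{[s ∈ {C,D,E}][h₂ ∉ C_η(h₁)]}`.
* `HubPairApex.r1_of_blocks` (Θ-IDENTITY ⇒ R1): the rows `B, E` do not charge the four R1 cells, and
  `K²·(Z(U_b)Z(U_c) − Z(T)Z(S)) = (∑ η : BondConfig V, rcWeightW wA q ({h₁, h₂} : Set V) η * ind {η : BondConfig V | h₁ ∈ cl η.toFinset a ∧ h₂ ∈ cl η.toFinset a} η)²·Q_A + (∑ η : BondConfig V, rcWeightW wA q ({h₁, h₂} : Set V) η * ind {η : BondConfig V | h₁ ∈ cl η.toFinset a ∧ h₂ ∉ cl η.toFinset a} η)²·Q_C + (∑ η : BondConfig V, rcWeightW wA q ({h₁, h₂} : Set V) η * ind {η : BondConfig V | h₁ ∉ cl η.toFinset a ∧ h₂ ∈ cl η.toFinset a} η)²·Q_D + (∑ η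 : BondConfig V, rcWeightW wA q ({h₁, h₂} : Set V) η * ind {η : BondConfig V | h₁ ∈ cl η.toFinset a ∧ h₂ ∈ cl η.toFinset a} η) (∑ η : BondConfig V, rcWeightW wA q ({h₁, h₂} : Set V) η * ind {η : BondConfig V | h₁ ∈ cl η.toFinset a ∧ h₂ ∉ cl η.toFinset a} η)·W⁰ + (∑ η : BondConfig V, rcWeightW wA q ({h₁, h₂} : Set V) η * ind {η : BondConfig V | h₁ ∈ cl η.toFinset a ∧ h₂ ∈ cl η.toFinset a} η) (∑ η : BondConfig V, rcWeightW wA q ({h₁, h₂} : Set V) η * ind {η : BondConfig V | h₁ ∉ cl η.toFinset a ∧ h₂ ∈ cl η.toFinset a} η)·W¹ + (∑ η : BondConfig V, rcWeightW wA q ({h₁, h₂} : Set V) η * ind {η : BondConfig V | h₁ ∈ cl η.toFinset a ∧ h₂ ∉ cl η.toFinset a} η) (∑ η : BondConfig V, rcWeightW wA q ({h₁, h₂} : Set V) η * ind {η : BondConfig V | h₁ ∉ cl η.toFinset a ∧ h₂ ∈ cl η.toFinset a} η)·CROSS` with `Q_s = R_s(U_b)R_s(U_c) − R_s(T)R_s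(S)`
  and the polar forms `W⁰ = X[R_A, R_C]`, `W¹ = X[R_A, R_D]`, `CROSS = X[R_C, R_D]`; hence **if the six blocks are `≥ 0` then R1 holds for `(a; b, c)` on
  the glued graph** (every `q > 0`).  Part 3 identifies the reference functionals with far-side cells: `R_C` = free cells of `DY` at apex `h₁`, `R_D` at apex
  `h₂`, `R_A` = `T`-wired cells — so `Q_C, Q_D, Q_A` are R1 slacks of the far side (free at either hub, wired), `CROSS` is gen 57's apex cross form and
  `W⁰, W¹` gen 65's free–wired forms: a minimal counterexample to R1-RC has no hub pair isolating the apex UNLESS `CROSS` or `W` fails on the far side.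
-/

noncomputable section

namespace Summit.CriticalPhenomena.PercolationContinuityZ3.Theorems

namespace HubPairApex

open Finset SimpleGraph Literature.Probability.Percolation Literature.Probability.Percolation.Gladkov
open Literature.Probability.Percolation.BHK2006 (weight)
open Literature.Probability.Percolation.DecisionTree (ind ind_of_mem ind_of_not_mem ind_nonneg)
open Literature.Probability.LatticeModels RefinedRowR3 ThreePointLB APL MeasureTheory
open scoped Classical

variable {V : Type*} [Fintype V]

/-! ### The dictionary -/

section Pointwise

variable {DA DY : Finset (Sym2 V)} {a h₁ h₂ : V} (h12 : h₁ ≠ h₂)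
  (hsepD : ∀ z : V, (∃ e ∈ DA, z ∈ e) → (∃ e ∈ DY, z ∈ e) → (z = h₁ ∨ z = h₂))
  (w : Sym2 V → unitInterval) (q : ℝ) (hw : ∀ e, e ∉ (↑DA ∪ ↑DY : Set (Sym2 V)) → (w e : ℝ) = 0)
include h12 hsepD hw

/-- **Pointwise dictionary**: for events with the replacement property, `K · rcW(ω) 1_{E_G}(ω)` splits along the state of `ω ∩ DA`. [this work] -/
theorem pt {EG E : Set (BondConfig V)}
    (hEA : (∀ ω : BondConfig V, ω ⊆ ↑DA ∪ ↑DY → (ω ∩ ↑DA) ∈ {η : BondConfig V | h₁ ∈ cl η.toFinset a ∧ h₂ ∈ cl η.toFinset a} → (ω ∈ EG ↔ ({s(a, h₁), s(a, h₂)} : Set (Sym2 V)) ∪ (ω \ ↑DA) ∈ E))) (hEB : (∀ ω : BondConfig V, ω ⊆ ↑DA ∪ ↑DY → (ω ∩ ↑DA) ∈ {η : BondConfig V | h₁ ∉ cl η.toFinset a ∧ h₂ ∉ cl η.toFinset a ∧ h₂ ∈ cl η.toFinset h₁} → (ω ∈ EG ↔ ({s(h₁, h₂)} : Set (Sym2 V))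 ∪ (ω \ ↑DA) ∈ E))) (hEC : (∀ ω : BondConfig V, ω ⊆ ↑DA ∪ ↑DY → (ω ∩ ↑DA) ∈ {η : BondConfig V | h₁ ∈ cl η.toFinset a ∧ h₂ ∉ cl η.toFinset a} → (ω ∈ EG ↔ ({s(a, h₁)} : Set (Sym2 V)) ∪ (ω \ ↑DA) ∈ E))) (hED : (∀ ω : BondConfig V, ω ⊆ ↑DA ∪ ↑DY → (ω ∩ ↑DA) ∈ {η : BondConfig V | h₁ ∉ cl η.toFinset a ∧ h₂ ∈ cl η.toFinset a} → (ω ∈ EG ↔ ({s(a, h₂)} : Set (Sym2 V)) ∪ (ω \ ↑DA) ∈ E))) (hEE : (∀ ω : BondConfig V, ω ⊆ ↑DA ∪ ↑DY → (ω ∩ ↑DA) ∈ {η : BondConfig V | h₁ ∉ cl η.toFinset a ∧ h₂ ∉ cl η.toFinset a ∧ h₂ ∉ cl η.toFinset h₁} → (ω ∈ EG ↔ (∅ : Set (Sym2 V)) ∪ (ω \ ↑DA) ∈ E))) (ω : BondConfig V) :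
    rcWeightW w q ∅ ω * ind EG ω * q ^ clusterCount (∅ : BondConfig V) ({h₁, h₂} : Set V) =
      weight (fun e => (w e : ℝ)) ω *
        ((ind {η : BondConfig V | h₁ ∈ cl η.toFinset a ∧ h₂ ∈ cl η.toFinset a} (ω ∩ ↑DA) * q ^ clusterCount (ω ∩ ↑DA) ({h₁, h₂} : Set V)) *
            (ind {η : BondConfig V | ({s(a, h₁), s(a, h₂)} : Set (Sym2 V)) ∪ η ∈ E} (ω \ ↑DA) * q ^ clusterCount (ω \ ↑DA) ({h₁, h₂} : Set V)) +
          (ind {η : BondConfig V | h₁ ∉ cl η.toFinset a ∧ h₂ ∉ cl η.toFinset a ∧ h₂ ∈ cl η.toFinset h₁} (ω ∩ ↑DA) * q ^ clusterCount (ω ∩ ↑DA) ({h₁, h₂} : Set V)) *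
            (ind {η : BondConfig V | ({s(h₁, h₂)} : Set (Sym2 V)) ∪ η ∈ E} (ω \ ↑DA) * q ^ clusterCount (ω \ ↑DA) ({h₁, h₂} : Set V)) +
          (ind {η : BondConfig V | h₁ ∈ cl η.toFinset a ∧ h₂ ∉ cl η.toFinset a} (ω ∩ ↑DA) * q ^ clusterCount (ω ∩ ↑DA) ({h₁, h₂} : Set V)) *
            ((ind {η : BondConfig V | ({s(a, h₁)} : Set (Sym2 V)) ∪ η ∈ E} (ω \ ↑DA) * (if (ω \ ↑DA) ∈ {η : BondConfig V | h₂ ∈ cl η.toFinset h₁} then 1 else q)) * q ^ clusterCount (ω \ ↑DA) ({h₁, h₂} : Set V)) +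
          (ind {η : BondConfig V | h₁ ∉ cl η.toFinset a ∧ h₂ ∈ cl η.toFinset a} (ω ∩ ↑DA) * q ^ clusterCount (ω ∩ ↑DA) ({h₁, h₂} : Set V)) *
            ((ind {η : BondConfig V | ({s(a, h₂)} : Set (Sym2 V)) ∪ η ∈ E} (ω \ ↑DA) * (if (ω \ ↑DA) ∈ {η : BondConfig V | h₂ ∈ cl η.toFinset h₁} then 1 else q)) * q ^ clusterCount (ω \ ↑DA) ({h₁, h₂} : Set V)) +
          (ind {η : BondConfig V | h₁ ∉ cl η.toFinset a ∧ h₂ ∉ cl η.toFinset a ∧ h₂ ∉ cl η.toFinset h₁} (ω ∩ ↑DA) * q ^ clusterCount (ω ∩ ↑DA) ({h₁, h₂} : Set V)) *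
            ((ind {η : BondConfig V | (∅ : Set (Sym2 V)) ∪ η ∈ E} (ω \ ↑DA) * (if (ω \ ↑DA) ∈ {η : BondConfig V | h₂ ∈ cl η.toFinset h₁} then 1 else q)) * q ^ clusterCount (ω \ ↑DA) ({h₁, h₂} : Set V))) := by
  by_cases hω : ω ⊆ ↑DA ∪ ↑DY
  swap
  · obtain ⟨e, heω, heD⟩ := Set.not_subset.1 hω
    have h0 := ApexTwoSum.weight_eq_zero_of_mem_not_mem w hw heω heD
    unfold rcWeightW
    rw [h0]; ring
  have hadd := ApexTwoSum.kT_add hsepD hω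
  have hglue := ApexTwoSum.glued_h_iff hsepD hω
  -- the arm-internal facts relating the three bits
  have armJ : ∀ η : BondConfig V, η ∈ {η : BondConfig V | h₁ ∈ cl η.toFinset a} → η ∈ {η : BondConfig V | h₂ ∈ cl η.toFinset a} → η ∈ {η : BondConfig V | h₂ ∈ cl η.toFinset h₁} := fun η h1 h2 =>
    mem_cl_trans (mem_cl_comm.1 h1) h2
  have armC : ∀ η : BondConfig V, η ∈ {η : BondConfig V | h₁ ∈ cl η.toFinset a} → η ∉ {η : BondConfig V | h₂ ∈ cl η.toFinset a} → η ∉ {η : BondConfig V | h₂ ∈ cl η.toFinset h₁} := fun η h1 h2 hj =>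
    h2 (mem_cl_trans h1 hj)
  have armD : ∀ η : BondConfig V, η ∉ {η : BondConfig V | h₁ ∈ cl η.toFinset a} → η ∈ {η : BondConfig V | h₂ ∈ cl η.toFinset a} → η ∉ {η : BondConfig V | h₂ ∈ cl η.toFinset h₁} := fun η h1 h2 hj =>
    h1 (mem_cl_trans h2 (mem_cl_comm.1 hj))
  by_cases c1 : (ω ∩ ↑DA) ∈ {η : BondConfig V | h₁ ∈ cl η.toFinset a}
  · by_cases c2 : (ω ∩ ↑DA) ∈ {η : BondConfig V | h₂ ∈ cl η.toFinset a}
    · -- state A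
      have hS : (ω ∩ ↑DA) ∈ {η : BondConfig V | h₁ ∈ cl η.toFinset a ∧ h₂ ∈ cl η.toFinset a} := ⟨c1, c2⟩
      have nB : (ω ∩ ↑DA) ∉ {η : BondConfig V | h₁ ∉ cl η.toFinset a ∧ h₂ ∉ cl η.toFinset a ∧ h₂ ∈ cl η.toFinset h₁} := fun h => h.1 c1
      have nC : (ω ∩ ↑DA) ∉ {η : BondConfig V | h₁ ∈ cl η.toFinset a ∧ h₂ ∉ cl η.toFinset a} := fun h => h.2 c2
      have nD : (ω ∩ ↑DA) ∉ {η : BondConfig V | h₁ ∉ cl η.toFinset a ∧ h₂ ∈ cl η.toFinset a} := fun h => h.1 c1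
      have nE : (ω ∩ ↑DA) ∉ {η : BondConfig V | h₁ ∉ cl η.toFinset a ∧ h₂ ∉ cl η.toFinset a ∧ h₂ ∉ cl η.toFinset h₁} := fun h => h.1 c1
      have hvu : h₂ ∈ cl ω.toFinset h₁ := hglue.2 (Or.inl (armJ _ c1 c2))
      have hk := ApexTwoSum.k_of_mem h12 ω hvu
      have hpow : q ^ clusterCount ω ∅ * q ^ clusterCount (∅ : BondConfig V) ({h₁, h₂} : Set V) = q ^ clusterCount (ω ∩ ↑DA) ({h₁, h₂} : Set V) * q ^ clusterCount (ω \ ↑DA) ({h₁, h₂} : Set V) := by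
        rw [← pow_add, hk, hadd, pow_add]
      rw [ind_of_mem hS, ind_of_not_mem nB, ind_of_not_mem nC, ind_of_not_mem nD, ind_of_not_mem nE]
      by_cases hE : ({s(a, h₁), s(a, h₂)} : Set (Sym2 V)) ∪ (ω \ ↑DA) ∈ E
      · have h1 : (ω \ ↑DA) ∈ {η : BondConfig V | ({s(a, h₁), s(a, h₂)} : Set (Sym2 V)) ∪ η ∈ E} := hE
        rw [ind_of_mem h1, ind_of_mem ((hEA ω hω hS).2 hE)]
        unfold rcWeightW
        linear_combination (weight (fun e => (w e : ℝ)) ω) * hpow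
      · have h1 : (ω \ ↑DA) ∉ {η : BondConfig V | ({s(a, h₁), s(a, h₂)} : Set (Sym2 V)) ∪ η ∈ E} := hE
        rw [ind_of_not_mem h1, ind_of_not_mem (fun h => hE ((hEA ω hω hS).1 h))]
        ring
    · -- state C
      have hS : (ω ∩ ↑DA) ∈ {η : BondConfig V | h₁ ∈ cl η.toFinset a ∧ h₂ ∉ cl η.toFinset a} := ⟨c1, c2⟩
      have nA : (ω ∩ ↑DA) ∉ {η : BondConfig V | h₁ ∈ cl η.toFinset a ∧ h₂ ∈ cl η.toFinset a} := fun h => c2 h.2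
      have nB : (ω ∩ ↑DA) ∉ {η : BondConfig V | h₁ ∉ cl η.toFinset a ∧ h₂ ∉ cl η.toFinset a ∧ h₂ ∈ cl η.toFinset h₁} := fun h => h.1 c1
      have nD : (ω ∩ ↑DA) ∉ {η : BondConfig V | h₁ ∉ cl η.toFinset a ∧ h₂ ∈ cl η.toFinset a} := fun h => h.1 c1
      have nE : (ω ∩ ↑DA) ∉ {η : BondConfig V | h₁ ∉ cl η.toFinset a ∧ h₂ ∉ cl η.toFinset a ∧ h₂ ∉ cl η.toFinset h₁} := fun h => h.1 c1
      have nJ : (ω ∩ ↑DA) ∉ {η : BondConfig V | h₂ ∈ cl η.toFinset h₁} := armC _ c1 c2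
      rw [ind_of_mem hS, ind_of_not_mem nA, ind_of_not_mem nB, ind_of_not_mem nD, ind_of_not_mem nE]
      by_cases hJY : (ω \ ↑DA) ∈ {η : BondConfig V | h₂ ∈ cl η.toFinset h₁}
      · have hvu : h₂ ∈ cl ω.toFinset h₁ := hglue.2 (Or.inr hJY)
        have hk := ApexTwoSum.k_of_mem h12 ω hvu
        have hpow : q ^ clusterCount ω ∅ * q ^ clusterCount (∅ : BondConfig V) ({h₁, h₂} : Set V) = q ^ clusterCount (ω ∩ ↑DA) ({h₁, h₂} : Set V) * q ^ clusterCount (ω \ ↑DA) ({h₁, h₂} : Set V) := by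
          rw [← pow_add, hk, hadd, pow_add]
        rw [if_pos hJY]
        by_cases hE : ({s(a, h₁)} : Set (Sym2 V)) ∪ (ω \ ↑DA) ∈ E
        · have h1 : (ω \ ↑DA) ∈ {η : BondConfig V | ({s(a, h₁)} : Set (Sym2 V)) ∪ η ∈ E} := hE
          rw [ind_of_mem h1, ind_of_mem ((hEC ω hω hS).2 hE)]
          unfold rcWeightW
          linear_combination (weight (fun e => (w e : ℝ)) ω) * hpow
        · have h1 : (ω \ ↑DA) ∉ {η : BondConfig V | ({s(a, h₁)} : Set (Sym2 V)) ∪ η ∈ E} := hE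
          rw [ind_of_not_mem h1, ind_of_not_mem (fun h => hE ((hEC ω hω hS).1 h))]
          ring
      · have hvu : h₂ ∉ cl ω.toFinset h₁ := fun h => (hglue.1 h).elim nJ hJY
        have hk := ApexTwoSum.k_of_not_mem h12 ω hvu
        have hpow : q ^ clusterCount ω ∅ * q ^ clusterCount (∅ : BondConfig V) ({h₁, h₂} : Set V) = q ^ clusterCount (ω ∩ ↑DA) ({h₁, h₂} : Set V) * q ^ clusterCount (ω \ ↑DA) ({h₁, h₂} : Set V) * q := by
          rw [hk, pow_succ, mul_right_comm, ← pow_add, hadd, pow_add]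
        rw [if_neg hJY]
        by_cases hE : ({s(a, h₁)} : Set (Sym2 V)) ∪ (ω \ ↑DA) ∈ E
        · have h1 : (ω \ ↑DA) ∈ {η : BondConfig V | ({s(a, h₁)} : Set (Sym2 V)) ∪ η ∈ E} := hE
          rw [ind_of_mem h1, ind_of_mem ((hEC ω hω hS).2 hE)]
          unfold rcWeightW
          linear_combination (weight (fun e => (w e : ℝ)) ω) * hpow
        · have h1 : (ω \ ↑DA) ∉ {η : BondConfig V | ({s(a, h₁)} : Set (Sym2 V)) ∪ η ∈ E} := hE
          rw [ind_of_not_mem h1, ind_of_not_mem (fun h => hE ((hEC ω hω hS).1 h))]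
          ring
  · by_cases c2 : (ω ∩ ↑DA) ∈ {η : BondConfig V | h₂ ∈ cl η.toFinset a}
    · -- state D
      have hS : (ω ∩ ↑DA) ∈ {η : BondConfig V | h₁ ∉ cl η.toFinset a ∧ h₂ ∈ cl η.toFinset a} := ⟨c1, c2⟩
      have nA : (ω ∩ ↑DA) ∉ {η : BondConfig V | h₁ ∈ cl η.toFinset a ∧ h₂ ∈ cl η.toFinset a} := fun h => c1 h.1
      have nB : (ω ∩ ↑DA) ∉ {η : BondConfig V | h₁ ∉ cl η.toFinset a ∧ h₂ ∉ cl η.toFinset a ∧ h₂ ∈ cl η.toFinset h₁} := fun h => h.2.1 c2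
      have nC : (ω ∩ ↑DA) ∉ {η : BondConfig V | h₁ ∈ cl η.toFinset a ∧ h₂ ∉ cl η.toFinset a} := fun h => c1 h.1
      have nE : (ω ∩ ↑DA) ∉ {η : BondConfig V | h₁ ∉ cl η.toFinset a ∧ h₂ ∉ cl η.toFinset a ∧ h₂ ∉ cl η.toFinset h₁} := fun h => h.2.1 c2
      have nJ : (ω ∩ ↑DA) ∉ {η : BondConfig V | h₂ ∈ cl η.toFinset h₁} := armD _ c1 c2
      rw [ind_of_mem hS, ind_of_not_mem nA, ind_of_not_mem nB, ind_of_not_mem nC, ind_of_not_mem nE]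
      by_cases hJY : (ω \ ↑DA) ∈ {η : BondConfig V | h₂ ∈ cl η.toFinset h₁}
      · have hvu : h₂ ∈ cl ω.toFinset h₁ := hglue.2 (Or.inr hJY)
        have hk := ApexTwoSum.k_of_mem h12 ω hvu
        have hpow : q ^ clusterCount ω ∅ * q ^ clusterCount (∅ : BondConfig V) ({h₁, h₂} : Set V) = q ^ clusterCount (ω ∩ ↑DA) ({h₁, h₂} : Set V) * q ^ clusterCount (ω \ ↑DA) ({h₁, h₂} : Set V) := by
          rw [← pow_add, hk, hadd, pow_add]
        rw [if_pos hJY]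
        by_cases hE : ({s(a, h₂)} : Set (Sym2 V)) ∪ (ω \ ↑DA) ∈ E
        · have h1 : (ω \ ↑DA) ∈ {η : BondConfig V | ({s(a, h₂)} : Set (Sym2 V)) ∪ η ∈ E} := hE
          rw [ind_of_mem h1, ind_of_mem ((hED ω hω hS).2 hE)]
          unfold rcWeightW
          linear_combination (weight (fun e => (w e : ℝ)) ω) * hpow
        · have h1 : (ω \ ↑DA) ∉ {η : BondConfig V | ({s(a, h₂)} : Set (Sym2 V)) ∪ η ∈ E} := hE
          rw [ind_of_not_mem h1, ind_of_not_mem (fun h => hE ((hED ω hω hS).1 h))]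
          ring
      · have hvu : h₂ ∉ cl ω.toFinset h₁ := fun h => (hglue.1 h).elim nJ hJY
        have hk := ApexTwoSum.k_of_not_mem h12 ω hvu
        have hpow : q ^ clusterCount ω ∅ * q ^ clusterCount (∅ : BondConfig V) ({h₁, h₂} : Set V) = q ^ clusterCount (ω ∩ ↑DA) ({h₁, h₂} : Set V) * q ^ clusterCount (ω \ ↑DA) ({h₁, h₂} : Set V) * q := by
          rw [hk, pow_succ, mul_right_comm, ← pow_add, hadd, pow_add]
        rw [if_neg hJY]
        by_cases hE : ({s(a, h₂)} : Set (Sym2 V)) ∪ (ω \ ↑DA) ∈ E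
        · have h1 : (ω \ ↑DA) ∈ {η : BondConfig V | ({s(a, h₂)} : Set (Sym2 V)) ∪ η ∈ E} := hE
          rw [ind_of_mem h1, ind_of_mem ((hED ω hω hS).2 hE)]
          unfold rcWeightW
          linear_combination (weight (fun e => (w e : ℝ)) ω) * hpow
        · have h1 : (ω \ ↑DA) ∉ {η : BondConfig V | ({s(a, h₂)} : Set (Sym2 V)) ∪ η ∈ E} := hE
          rw [ind_of_not_mem h1, ind_of_not_mem (fun h => hE ((hED ω hω hS).1 h))]
          ring
    · by_cases cJ : (ω ∩ ↑DA) ∈ {η : BondConfig V | h₂ ∈ cl η.toFinset h₁}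
      · -- state B
        have hS : (ω ∩ ↑DA) ∈ {η : BondConfig V | h₁ ∉ cl η.toFinset a ∧ h₂ ∉ cl η.toFinset a ∧ h₂ ∈ cl η.toFinset h₁} := ⟨c1, c2, cJ⟩
        have nA : (ω ∩ ↑DA) ∉ {η : BondConfig V | h₁ ∈ cl η.toFinset a ∧ h₂ ∈ cl η.toFinset a} := fun h => c1 h.1
        have nC : (ω ∩ ↑DA) ∉ {η : BondConfig V | h₁ ∈ cl η.toFinset a ∧ h₂ ∉ cl η.toFinset a} := fun h => c1 h.1
        have nD : (ω ∩ ↑DA) ∉ {η : BondConfig V | h₁ ∉ cl η.toFinset a ∧ h₂ ∈ cl η.toFinset a} := fun h => c2 h.2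
        have nE : (ω ∩ ↑DA) ∉ {η : BondConfig V | h₁ ∉ cl η.toFinset a ∧ h₂ ∉ cl η.toFinset a ∧ h₂ ∉ cl η.toFinset h₁} := fun h => h.2.2 cJ
        have hvu : h₂ ∈ cl ω.toFinset h₁ := hglue.2 (Or.inl cJ)
        have hk := ApexTwoSum.k_of_mem h12 ω hvu
        have hpow : q ^ clusterCount ω ∅ * q ^ clusterCount (∅ : BondConfig V) ({h₁, h₂} : Set V) = q ^ clusterCount (ω ∩ ↑DA) ({h₁, h₂} : Set V) * q ^ clusterCount (ω \ ↑DA) ({h₁, h₂} : Set V) := by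
          rw [← pow_add, hk, hadd, pow_add]
        rw [ind_of_mem hS, ind_of_not_mem nA, ind_of_not_mem nC, ind_of_not_mem nD, ind_of_not_mem nE]
        by_cases hE : ({s(h₁, h₂)} : Set (Sym2 V)) ∪ (ω \ ↑DA) ∈ E
        · have h1 : (ω \ ↑DA) ∈ {η : BondConfig V | ({s(h₁, h₂)} : Set (Sym2 V)) ∪ η ∈ E} := hE
          rw [ind_of_mem h1, ind_of_mem ((hEB ω hω hS).2 hE)]
          unfold rcWeightW
          linear_combination (weight (fun e => (w e : ℝ)) ω) * hpow
        · have h1 : (ω \ ↑DA) ∉ {η : BondConfig V | ({s(h₁, h₂)} : Set (Sym2 V)) ∪ η ∈ E} := hE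
          rw [ind_of_not_mem h1, ind_of_not_mem (fun h => hE ((hEB ω hω hS).1 h))]
          ring
      · -- state E
        have hS : (ω ∩ ↑DA) ∈ {η : BondConfig V | h₁ ∉ cl η.toFinset a ∧ h₂ ∉ cl η.toFinset a ∧ h₂ ∉ cl η.toFinset h₁} := ⟨c1, c2, cJ⟩
        have nA : (ω ∩ ↑DA) ∉ {η : BondConfig V | h₁ ∈ cl η.toFinset a ∧ h₂ ∈ cl η.toFinset a} := fun h => c1 h.1
        have nB : (ω ∩ ↑DA) ∉ {η : BondConfig V | h₁ ∉ cl η.toFinset a ∧ h₂ ∉ cl η.toFinset a ∧ h₂ ∈ cl η.toFinset h₁} := fun h => cJ h.2.2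
        have nC : (ω ∩ ↑DA) ∉ {η : BondConfig V | h₁ ∈ cl η.toFinset a ∧ h₂ ∉ cl η.toFinset a} := fun h => c1 h.1
        have nD : (ω ∩ ↑DA) ∉ {η : BondConfig V | h₁ ∉ cl η.toFinset a ∧ h₂ ∈ cl η.toFinset a} := fun h => c2 h.2
        rw [ind_of_mem hS, ind_of_not_mem nA, ind_of_not_mem nB, ind_of_not_mem nC, ind_of_not_mem nD]
        by_cases hJY : (ω \ ↑DA) ∈ {η : BondConfig V | h₂ ∈ cl η.toFinset h₁}
        · have hvu : h₂ ∈ cl ω.toFinset h₁ := hglue.2 (Or.inr hJY)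
          have hk := ApexTwoSum.k_of_mem h12 ω hvu
          have hpow : q ^ clusterCount ω ∅ * q ^ clusterCount (∅ : BondConfig V) ({h₁, h₂} : Set V) = q ^ clusterCount (ω ∩ ↑DA) ({h₁, h₂} : Set V) * q ^ clusterCount (ω \ ↑DA) ({h₁, h₂} : Set V) := by
            rw [← pow_add, hk, hadd, pow_add]
          rw [if_pos hJY]
          by_cases hE : (∅ : Set (Sym2 V)) ∪ (ω \ ↑DA) ∈ E
          · have h1 : (ω \ ↑DA) ∈ {η : BondConfig V | (∅ : Set (Sym2 V)) ∪ η ∈ E} := hE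
            rw [ind_of_mem h1, ind_of_mem ((hEE ω hω hS).2 hE)]
            unfold rcWeightW
            linear_combination (weight (fun e => (w e : ℝ)) ω) * hpow
          · have h1 : (ω \ ↑DA) ∉ {η : BondConfig V | (∅ : Set (Sym2 V)) ∪ η ∈ E} := hE
            rw [ind_of_not_mem h1, ind_of_not_mem (fun h => hE ((hEE ω hω hS).1 h))]
            ring
        · have hvu : h₂ ∉ cl ω.toFinset h₁ := fun h => (hglue.1 h).elim cJ hJY
          have hk := ApexTwoSum.k_of_not_mem h12 ω hvu
          have hpow : q ^ clusterCount ω ∅ * q ^ clusterCount (∅ : BondConfig V) ({h₁, h₂} : Set V) = q ^ clusterCount (ω ∩ ↑DA) ({h₁, h₂} : Set V) * q ^ clusterCount (ω \ ↑DA) ({h₁, h₂} : Set V) * q := by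
            rw [hk, pow_succ, mul_right_comm, ← pow_add, hadd, pow_add]
          rw [if_neg hJY]
          by_cases hE : (∅ : Set (Sym2 V)) ∪ (ω \ ↑DA) ∈ E
          · have h1 : (ω \ ↑DA) ∈ {η : BondConfig V | (∅ : Set (Sym2 V)) ∪ η ∈ E} := hE
            rw [ind_of_mem h1, ind_of_mem ((hEE ω hω hS).2 hE)]
            unfold rcWeightW
            linear_combination (weight (fun e => (w e : ℝ)) ω) * hpow
          · have h1 : (ω \ ↑DA) ∉ {η : BondConfig V | (∅ : Set (Sym2 V)) ∪ η ∈ E} := hE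
            rw [ind_of_not_mem h1, ind_of_not_mem (fun h => hE ((hEE ω hω hS).1 h))]
            ring

end Pointwise

section Sums

variable {DA DY : Finset (Sym2 V)} {a h₁ h₂ : V} (h12 : h₁ ≠ h₂)
  (hsepD : ∀ z : V, (∃ e ∈ DA, z ∈ e) → (∃ e ∈ DY, z ∈ e) → (z = h₁ ∨ z = h₂))
  (w wA wY : Sym2 V → unitInterval) {q : ℝ} (hw : ∀ e, e ∉ (↑DA ∪ ↑DY : Set (Sym2 V)) → (w e : ℝ) = 0)
  (hX : ∀ e ∈ (↑DA : Set (Sym2 V)), wA e = w e) (hX' : ∀ e ∉ (↑DA : Set (Sym2 V)), wA e = 0)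
  (hY : ∀ e ∈ (↑DA : Set (Sym2 V)), wY e = 0) (hY' : ∀ e ∉ (↑DA : Set (Sym2 V)), wY e = w e)
include h12 hsepD hw hX hX' hY hY'

/-- **The dictionary**: `K · Zφ(E_G) = Σ_s X_s · R_s(E)` over the five apex-arm states. [this work] -/
theorem sum_eq {EG E : Set (BondConfig V)}
    (hEA : (∀ ω : BondConfig V, ω ⊆ ↑DA ∪ ↑DY → (ω ∩ ↑DA) ∈ {η : BondConfig V | h₁ ∈ cl η.toFinset a ∧ h₂ ∈ cl η.toFinset a} → (ω ∈ EG ↔ ({s(a, h₁), s(a, h₂)} : Set (Sym2 V)) ∪ (ω \ ↑DA) ∈ E))) (hEB : (∀ ω : BondConfig V, ω ⊆ ↑DA ∪ ↑DY → (ω ∩ ↑DA) ∈ {η : BondConfig V | h₁ ∉ cl η.toFinset a ∧ h₂ ∉ cl η.toFinset a ∧ h₂ ∈ cl η.toFinset h₁} → (ω ∈ EG ↔ ({s(h₁, h₂)} : Set (Sym2 V)) ∪ (ω \ ↑DA) ∈ E))) (hEC : (∀ ω : BondConfig V, ω ⊆ ↑DA ∪ ↑DY → (ω ∩ ↑DA)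 ∈ {η : BondConfig V | h₁ ∈ cl η.toFinset a ∧ h₂ ∉ cl η.toFinset a} → (ω ∈ EG ↔ ({s(a, h₁)} : Set (Sym2 V)) ∪ (ω \ ↑DA) ∈ E))) (hED : (∀ ω : BondConfig V, ω ⊆ ↑DA ∪ ↑DY → (ω ∩ ↑DA) ∈ {η : BondConfig V | h₁ ∉ cl η.toFinset a ∧ h₂ ∈ cl η.toFinset a} → (ω ∈ EG ↔ ({s(a, h₂)} : Set (Sym2 V)) ∪ (ω \ ↑DA) ∈ E))) (hEE : (∀ ω : BondConfig V, ω ⊆ ↑DA ∪ ↑DY → (ω ∩ ↑DA) ∈ {η : BondConfig V | h₁ ∉ cl η.toFinset a ∧ h₂ ∉ cl η.toFinset a ∧ h₂ ∉ cl η.toFinset h₁} → (ω ∈ EG ↔ (∅ : Set (Sym2 V)) ∪ (ω \ ↑DA) ∈ E))) :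
    (∑ ω : BondConfig V, rcWeightW w q ∅ ω * ind EG ω) * q ^ clusterCount (∅ : BondConfig V) ({h₁, h₂} : Set V) =
      (∑ η : BondConfig V, rcWeightW wA q ({h₁, h₂} : Set V) η * ind {η : BondConfig V | h₁ ∈ cl η.toFinset a ∧ h₂ ∈ cl η.toFinset a} η) * (∑ η : BondConfig V, rcWeightW wY q ({h₁, h₂} : Set V) η * ind {η : BondConfig V | ({s(a, h₁), s(a, h₂)} : Set (Sym2 V)) ∪ η ∈ E} η) + (∑ η : BondConfig V, rcWeightW wA q ({h₁, h₂} : Set V) η * ind {η : BondConfig V | h₁ ∉ cl η.toFinset a ∧ h₂ ∉ cl η.toFinset a ∧ h₂ ∈ cl η.toFinset h₁} η) * (∑ η : BondConfig V, rcWeightW wY q ({h₁, h₂} : Set V) η * ind {η : BondConfig V | ({s(h₁, h₂)} : Set (Sym2 V)) ∪ η ∈ E} η) + (∑ η : BondConfig V, rcWeightW wA q ({h₁, h₂} : Set V) η * ind {η : BondConfig V | h₁ ∈ cl η.toFinset a ∧ h₂ ∉ cl η.toFinset a} η) * (∑ η : BondConfig V, rcWeightW wY q ({h₁, h₂} : Set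 V) η * (ind {η : BondConfig V | ({s(a, h₁)} : Set (Sym2 V)) ∪ η ∈ E} η * (if η ∈ {η : BondConfig V | h₂ ∈ cl η.toFinset h₁} then 1 else q))) + (∑ η : BondConfig V, rcWeightW wA q ({h₁, h₂} : Set V) η * ind {η : BondConfig V | h₁ ∉ cl η.toFinset a ∧ h₂ ∈ cl η.toFinset a} η) * (∑ η : BondConfig V, rcWeightW wY q ({h₁, h₂} : Set V) η * (ind {η : BondConfig V | ({s(a, h₂)} : Set (Sym2 V)) ∪ η ∈ E} η * (if η ∈ {η : BondConfig V | h₂ ∈ cl η.toFinset h₁} then 1 else q))) + (∑ η : BondConfig V, rcWeightW wA q ({h₁, h₂} : Set V) η * ind {η : BondConfig V | h₁ ∉ cl η.toFinset a ∧ h₂ ∉ cl η.toFinset a ∧ h₂ ∉ cl η.toFinset h₁} η) * (∑ η : BondConfig V, rcWeightW wY q ({h₁, h₂} : Set V) η * (ind {η : BondConfig V | (∅ : Set (Sym2 V)) ∪ η ∈ E} η * (if η ∈ {η : BondConfig V | h₂ ∈ cl η.toFinset h₁} then 1 else q))) := by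
  rw [Finset.sum_mul, Finset.sum_congr rfl fun ω _ => pt h12 hsepD w q hw hEA hEB hEC hED hEE ω]
  simp only [mul_add]
  rw [Finset.sum_add_distrib, Finset.sum_add_distrib, Finset.sum_add_distrib, Finset.sum_add_distrib]
  have eA := ApexTwoSum.sum_weight_blocks_rc w wA wY (↑DA) hX hX' hY hY' q ({h₁, h₂} : Set V)
    (fun x => ind {η : BondConfig V | h₁ ∈ cl η.toFinset a ∧ h₂ ∈ cl η.toFinset a} x) (fun y => ind {η : BondConfig V | ({s(a, h₁), s(a, h₂)} : Set (Sym2 V)) ∪ η ∈ E} y)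
  have eB := ApexTwoSum.sum_weight_blocks_rc w wA wY (↑DA) hX hX' hY hY' q ({h₁, h₂} : Set V)
    (fun x => ind {η : BondConfig V | h₁ ∉ cl η.toFinset a ∧ h₂ ∉ cl η.toFinset a ∧ h₂ ∈ cl η.toFinset h₁} x) (fun y => ind {η : BondConfig V | ({s(h₁, h₂)} : Set (Sym2 V)) ∪ η ∈ E} y)
  have eC := ApexTwoSum.sum_weight_blocks_rc w wA wY (↑DA) hX hX' hY hY' q ({h₁, h₂} : Set V)
    (fun x => ind {η : BondConfig V | h₁ ∈ cl η.toFinset a ∧ h₂ ∉ cl η.toFinset a} x) (fun y => ind {η : BondConfig V | ({s(a, h₁)} : Set (Sym2 V)) ∪ η ∈ E} y * (if y ∈ {η : BondConfig V | h₂ ∈ cl η.toFinset h₁} then 1 else q))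
  have eD := ApexTwoSum.sum_weight_blocks_rc w wA wY (↑DA) hX hX' hY hY' q ({h₁, h₂} : Set V)
    (fun x => ind {η : BondConfig V | h₁ ∉ cl η.toFinset a ∧ h₂ ∈ cl η.toFinset a} x) (fun y => ind {η : BondConfig V | ({s(a, h₂)} : Set (Sym2 V)) ∪ η ∈ E} y * (if y ∈ {η : BondConfig V | h₂ ∈ cl η.toFinset h₁} then 1 else q))
  have eE := ApexTwoSum.sum_weight_blocks_rc w wA wY (↑DA) hX hX' hY hY' q ({h₁, h₂} : Set V)
    (fun x => ind {η : BondConfig V | h₁ ∉ cl η.toFinset a ∧ h₂ ∉ cl η.toFinset a ∧ h₂ ∉ cl η.toFinset h₁} x) (fun y => ind {η : BondConfig V | (∅ : Set (Sym2 V)) ∪ η ∈ E} y * (if y ∈ {η : BondConfig V | h₂ ∈ cl η.toFinset h₁} then 1 else q))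
  beta_reduce at eA eB eC eD eE
  rw [← eA, ← eB, ← eC, ← eD, ← eE]

end Sums


end HubPairApex

end Summit.CriticalPhenomena.PercolationContinuityZ3.Theorems
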